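import Literature.NumberTheory.EllipticCurves.ModularParametrizationDegreeProofs
import Literature.NumberTheory.EllipticCurves.ModularParametrizationDegreeHoldsProofs
import HarnessLib

/-!
# `IsNewformOf.exists_maninConstant_modularDegree` holds

Topic `NumberTheory/EllipticCurves`; a proofs-only sibling of `ModularParametrization.lean`
(theorems only: no definition, no named fact, nothing restated; D-0026). It discharges the named
fact `Literature.NumberTheory.EllipticCurves.ModularForms.IsNewformOf.exists_maninConstant_modularDegree`
(Breuil–Conrad–Diamond–Taylor 2001, Thm. A in the form (6) of p. 845 — "(2) ⇒ (6) follows from a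
construction of Shimura [Sh2] and a theorem of Faltings [Fa1]" — made analytic on `ℂ/Λ_E` for
`X₀(N)`): for a globally minimal elliptic curve `W/ℚ` with newform `f ∈ S₂(Γ₀(N))`
(`IsNewformOf W f`) and a Néron-type period pair `L` of `W`, there are an integer `c` with
`c·Λ_f ⊆ Λ_L` (`Λ_f` the period lattice of `2πi f(τ)dτ`) and a degree `d ≥ 1` such that
`Γ₀(N)τ ↦ c · 2πi ∫_{i∞}^τ f (mod Λ_L)` has exactly `d` orbits in all but finitely many fibres.

The printed proof has two halves, both theorems of the tree:

* the *arithmetic half* `IsNewformOf.exists_maninConstant_ne_zero` — a non-zero integer `c` with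
  `c·Λ_f ⊆ Λ_L` — discharged in `ModularParametrizationDegreeHoldsProofs`
  (`IsNewformOf.exists_maninConstant_ne_zero_holds`: Shimura's construction `E_f = ℂ/Λ_f` with the
  Eichler–Shimura congruence by Honda's method, and Faltings' isogeny theorem
  `WeierstrassCurve.isIsogenous_iff_frobeniusTrace_eq_holds`);
* the *Riemann-surface half* — for every `c ≠ 0` with `c·Λ_f ⊆ Λ` the holomorphic map
  `Y₀(N) → ℂ/Λ` extends over the cusps and has a degree — `exists_modularDegree_holds`
  (`ModularParametrizationDegreeProofs`, Farkas–Kra Prop. I.1.6), assembled there with the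
  arithmetic half as `exists_maninConstant_modularDegree_of_ne_zero`.

This file is the one-line composition. (The converse — the fact implies
`IsNewformOf.exists_maninConstant_ne_zero` for every elliptic `W/ℚ` — is
`exists_maninConstant_modularDegree_iff_exists_maninConstant_ne_zero` in
`ModularParametrizationResidualProofs`.)

## References

* C. Breuil, B. Conrad, F. Diamond, R. Taylor, *On the modularity of elliptic curves over `ℚ`:
  wild 3-adic exercises*, J. Amer. Math. Soc. 14 (2001), 843–939; Thm. A and p. 845,
  conditions (1)–(6), "(2) ⇒ (6)" (held: `doi-10-1090-s0894-0347-01-00370-8`, PDF p. 4, read).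
  [BCDTJAMS2001]
* G. Shimura, *Introduction to the arithmetic theory of automorphic functions* (1971), Thm. 7.14,
  Thm. 7.15. [ShimuraIATAF1971]
* G. Faltings, *Endlichkeitssätze für abelsche Varietäten über Zahlkörpern*, Invent. Math. 73
  (1983), §5 Korollar 2. [Faltings1983Endlichkeit]
* H. M. Farkas, I. Kra, *Riemann surfaces*, 2nd ed. (1992), Prop. I.1.6. [FarkasKra1992]
-/

namespace Literature.NumberTheory.EllipticCurves.ModularForms

/-- **`IsNewformOf.exists_maninConstant_modularDegree` holds** (Breuil–Conrad–Diamond–Taylor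
2001, Thm. A in the form (6) of p. 845, on `ℂ/Λ_E` for `X₀(N)`): for a globally minimal elliptic
curve `W/ℚ` with newform `f ∈ S₂(Γ₀(N))` and a Néron-type period pair `L` of `W`, some integer `c`
has `c·Λ_f ⊆ Λ_L`, and for some `d ≥ 1` the map `Γ₀(N)τ ↦ c · 2πi ∫_{i∞}^τ f (mod Λ_L)` on `Y₀(N)`
has exactly `d` orbits in every fibre off a finite set. Proof: the arithmetic half
`IsNewformOf.exists_maninConstant_ne_zero_holds` (Shimura's construction + Faltings) fed to
`exists_maninConstant_modularDegree_of_ne_zero` (the Riemann-surface half,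
`exists_modularDegree_holds`).
[cite: BCDTJAMS2001, Thm. A with (6) of p. 845, "(2) ⇒ (6)"]
[cite: ShimuraIATAF1971, Thm. 7.14 and Thm. 7.15] [cite: Faltings1983Endlichkeit, §5 Korollar 2]
[cite: FarkasKra1992, Prop. I.1.6] -/
theorem IsNewformOf.exists_maninConstant_modularDegree_holds :
    IsNewformOf.exists_maninConstant_modularDegree :=
  exists_maninConstant_modularDegree_of_ne_zero IsNewformOf.exists_maninConstant_ne_zero_holds

end Literature.NumberTheory.EllipticCurves.ModularForms
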